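import Summits.QuantumFields.YangMills.Theorems.BalabanUVNodesN15SizedKnitSocket
import HarnessLib

/-!
# N15 = NE2 — PROGRAMME Ð (Ð-6): THE SIZED KNIT SOCKET's UNIT LAYER WITH A GENUINE DIRICHLET REGION — Bałaban's own `U ≡ 1` covariance `C^{(k)}_Λ = C_Λ(C_Λ*Δ_kC_Λ)⁻¹C_Λ*` of
# EVERY region `Λ = B(Λ′₀) ⊂ T` ([B6] (2.154)–(2.156); [B9] §E), `NE2PlusUnit` BY NAME with `inΛ y :⟺ ȳ ∈ Λ`, for ANY paired-instance family on S-D's size-live carrier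
# (dag-n15-a g30, programme Ð «Dirichlet», FILE (Ð-6); node N15 = NE2; `--supports stmt-QuantumFields-27366 --as helper`, count-neutral; plumbing defs `covDiffLam`, `covOnSLam`, `inLamS` + theorems)

WHY.  S-D `…N15SizedKnitSocket` (this lane, part 85) is the socket every realised family of the lineage is knitted through: operator layer BY NAME ⟹ `N15At` with the two genuine `U ≡ 1`
kernel layers, the UNIT one being part 76's (2.156) covariance η-difference `covOnS` on THE WHOLE unit torus (`inΛ := ⊤`; ref-B READ-986 NIT (b), READ-989 (ii): «no Dirichlet region Λ,
whereas the print's object is `C^{(k)}_Λ`»).  The Literature ALREADY holds the U ≡ 1 Dirichlet covariance and its η-rate for every `Λ = B(Λ′₀)` — `B6Cov2156TorusSubset.bondReductionLam`,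
`T4Cov2156Rate.cov2156_rate_lam` (King's (4.38) shape, ONE `(C′, δ′)` in `(d, L)`, uniform in the torus AND the region).  This file re-bases it on the socket exactly as S-D re-based part 76:
the unit conjunct of EVERY socket family (the sized pair of record `tgInstanceS`, dag-n15-c's sized families, the K3⁸ v7 pin's `N15PinnedSized` shape) now has a Dirichlet edition with a
genuine region predicate, and the socket theorems `n15At_opGeoS_…` ∕ `live_opGeoS` get their Λ-twins.  (The U-LIVE coloured Dirichlet unit layer on dag-n15-c's carrier is (Ð-4)∕(Ð-5).)

WHAT.  §1 def `covDiffLam L M k m Λ'₀ p q := C^{(L^{k+m})}_Λ(p,q) − C^{(L^k)}_Λ(p,q)` (`bondReductionLam`), ★ `covDiffLam_eq_covDiff` (Λ′₀ ⊇ all coarse sites ⇒ = part 76's `covDiff`),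
`covDiffLam_eq_zero_of_not_isLam` (DIRICHLET: row of a bond not meeting Λ vanishes); §2 defs `covOnSLam … Λr i` (the kernel on the socket carrier, region map `Λr : I → Finset (Fin (d+1) → ℤ)`),
`inLamS … Λr i y :⟺ InLam L M (Λr i) (rep y)`; `covOnSLam_ker`, `inLamS_iff`, `inLamS_zero`; ★★ `ne2PlusUnit_covOnSLam` (`NE2PlusUnit` BY NAME, constants `(δ₀, 1, B₀, L⁻¹)` of
`cov2156_rate_lam`, uniform in `i` AND `Λr i`; regularity hypotheses idle on a U-blind kernel — said); §3 socket theorems: ★★★ `n15At_opGeoS_of_ne2PlusOperator_lam` (operator layer BY NAME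
⟹ `N15At ⟨…, siteOnS, covOnSLam Λr, inLamS Λr, dist⟩`), ★★ `live_opGeoS_lam` (guard for ANY kernels when `(Mc, k∘ι)` is jointly cofinal, the trivial configuration regular, and every
`Λr i ∋ 0`), ★★ `live_and_n15At_opGeoS_of_ne2PlusOperator_lam`, keyed face `s_N15_of_admits_opGeoS_of_ne2PlusOperator_lam`.

HONEST FRAMING ∕ LIMITS.  Count-neutral kernel bookkeeping BY NAME over the Literature's Λ-rows (`bondReductionLam`, `cov2156_rate_lam`, `lamFree_univ`, `elimT_eq_zero_of_not_isLam`); NO new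
estimate.  The unit kernel is U-BLIND (`U ≡ 1` object of [B6] (2.156); the «+» of NE2⁺ inert — as S-D said); the region is [B6] Lemma 2.4's `Λ = B(Λ′₀)` for ANY finite `Λ′₀` ([B9] §E's side
conditions on Λ not needed, not imposed).  NOT [B9] Thm 3.15 AS PRINTED (general U).  N15 stays DISCHARGED OF RECORD AS CONSUMED (U-blind v7 pin, p687738) — no re-pin asked, nothing re-claimed,
no count moved; K3⁸ OPEN; one finite 𝕋⁴ at fixed ε per index — NOT ℝ⁴ ∕ infinite volume ∕ OS ∕ mass gap ∕ Clay.  No `sorry`, `instance`, `notation`, `maxHeartbeats`; standard axioms.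
[cite: Balaban1984PropagatorsII, Lemma 2.4 p.245, (2.152)–(2.157) pp.249–250 («or on a subset Λ ⊂ T^{(k)}», `C^{(k)}_Λ = C(C*Δ_kC)⁻¹C*`); Balaban1985BackgroundPropagators, §E pp.427–428, Thm 3.15 (3.187) p.432 (quantifier template, «y, y′ ∈ Λ», constants in d, L only); King1986, Lemma 4.5 (4.38) p.674 (shape)]
-/

set_option autoImplicit false

noncomputable section
namespace Summit.QuantumFields.YangMills.BalabanUVNodes.N15.GenuineRecord

open Literature.MathematicalPhysics.QuantumFieldTheory.Balaban1983to89
open Literature.MathematicalPhysics.QuantumFieldTheory.Balaban1983to89.T4Continuum (T4Family ULoop)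
open Literature.MathematicalPhysics.QuantumFieldTheory.Balaban1983to89.T4EtaRate (EtaPairing PairedInstance NE2PlusOperator NE2PlusSite NE2PlusUnit EtaRateIneqUnit)
open Literature.MathematicalPhysics.QuantumFieldTheory.Balaban1983to89.B5Prop11Plancherel (Tor fine)
open Literature.MathematicalPhysics.QuantumFieldTheory.Balaban1983to89.B6Lemma24Torus (pbox coarseSites)
open Literature.MathematicalPhysics.QuantumFieldTheory.Balaban1983to89.B6BondEliminationTorus (pdist)
open Literature.MathematicalPhysics.QuantumFieldTheory.Balaban1983to89.B6Cov2156Torus (deltaPol one_le_M freeT bondReductionT)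
open Literature.MathematicalPhysics.QuantumFieldTheory.Balaban1983to89.B6Cov2156TorusSubset (IsLam lamFree lamFree_subset lamFree_univ bondReductionLam subFamilyT subFamilyT_cov
  mem_lamFree elimT_eq_zero_of_not_isLam)
open Literature.MathematicalPhysics.QuantumFieldTheory.Balaban1983to89.B6LowerBound2153Torus (rep rep_mem_pbox InLam pos_of_neZero)
open Literature.MathematicalPhysics.QuantumFieldTheory.Balaban1983to89.B6UnitTorusCarrier (pdist_rep_rep)
open Literature.MathematicalPhysics.QuantumFieldTheory.Balaban1983to89.T4Cov2156Rate (cov2156_rate_lam)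
open Literature.MathematicalPhysics.QuantumFieldTheory.Balaban1983to89.T4EtaRateUnitWitness (covDiff)
open Literature.MathematicalPhysics.QuantumFieldTheory.King1986.Torus (tdistT)
open Node00 (NE2Objects₁₁)
open Summit.QuantumFields.YangMills.BalabanUVNodes.N15.OperatorReadout (opGeo)
open Summit.QuantumFields.YangMills.BalabanUVNodes.N15.TwoGrid (TGIndex tgGeoC)
open Summit.QuantumFields.YangMills.BalabanUVNodes.N15.AtKeyedHome (s_N15_of_admits)
open Summit.QuantumFields.YangMills.BalabanUVNodes.N15.PairedFamilyGuard (Live)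
open YMDAG.UVSplit (Datum NE2Carriers RateCarriers RateRecordPred N15At S_N15 ne2OfRecord₁₁)

variable {d : ℕ} {L : ℕ} [NeZero L]

/-! ## §1 The (2.156) η-difference with Dirichlet elimination outside `Λ = B(Λ′₀)` -/

section Diff

variable {d' : ℕ} (L' : ℕ) (M : Fin d' → ℕ) [∀ μ, NeZero (M μ)]

/-- **THE U ≡ 1 UNIT-LATTICE η-DIFFERENCE WITH DIRICHLET ELIMINATION**: `C^{(L^{k+m})}_Λ(p,q) − C^{(L^k)}_Λ(p,q)` for the Literature's `C^{(n)}_Λ = C_Λ(C_Λ*Δ^{(n)}C_Λ)⁻¹C_Λ*`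
(`bondReductionLam`, region `Λ = B(Λ′₀)`, [B6] Lemma 2.4's bond convention), a function on ALL bonds of the torus (zero at bonds not meeting Λ). [cite: Balaban1984PropagatorsII, (2.154)–(2.156) pp.249–250 (object); King1986, Lemma 4.5 (4.38) p.674 (shape)] -/
def covDiffLam (k m : ℕ) (Λ'₀ : Finset (Fin d' → ℤ)) (p q : B4.Idx (pbox M) d') : ℝ :=
  (bondReductionLam L' M Λ'₀ (deltaPol M (L' ^ (k + m)))).cov p q - (bondReductionLam L' M Λ'₀ (deltaPol M (L' ^ k))).cov p q

variable {L' M}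

omit [∀ μ, NeZero (M μ)] in
/-- At a sub-family that IS the whole family the sub-family covariance is b06's torus covariance. [folklore] -/
theorem subFamilyT_cov_eq_of_eq {S : Finset (B4.Idx (pbox M) d')} (hS : S ⊆ freeT L' M) (hSe : S = freeT L' M) (Δ : Matrix (B4.Idx (pbox M) d') (B4.Idx (pbox M) d') ℝ) :
    (subFamilyT L' M S hS Δ).cov = (bondReductionT L' M Δ).cov := by
  subst hSe; rfl

/-- ★ **CONSISTENCY — `Λ′₀ ⊇` ALL COARSE SITES ⇒ THE DIRICHLET η-DIFFERENCE IS PART 76's TORUS η-DIFFERENCE `covDiff`** (Literature `lamFree_univ`). [cite: Balaban1984PropagatorsII, (2.156) p.250] -/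
theorem covDiffLam_eq_covDiff (hL : 0 < L') {Λ'₀ : Finset (Fin d' → ℤ)} (hΛ : coarseSites L' M ⊆ Λ'₀) (k m : ℕ) (p q : B4.Idx (pbox M) d') :
    covDiffLam L' M k m Λ'₀ p q = covDiff L' M k m p q := by
  unfold covDiffLam covDiff
  rw [subFamilyT_cov_eq_of_eq (lamFree_subset L' M Λ'₀) (lamFree_univ hL hΛ), subFamilyT_cov_eq_of_eq (lamFree_subset L' M Λ'₀) (lamFree_univ hL hΛ)]

/-- ★ **DIRICHLET — p.250 «CB′ = 0 OUTSIDE Λ»**: at a bond `p` NOT meeting `Λ = B(Λ′₀)` every `C^{(n)}_Λ(p, ·)` vanishes, hence so does the η-difference (Literature `elimT_eq_zero_of_not_isLam`).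
[cite: Balaban1984PropagatorsII, p.250, Lemma 2.4 p.245] -/
theorem covDiffLam_eq_zero_of_not_isLam (hL : 0 < L') (hLM : ∀ μ, L' ∣ M μ) (k m : ℕ) (Λ'₀ : Finset (Fin d' → ℤ)) {p : B4.Idx (pbox M) d'} (hp : ¬ IsLam L' M Λ'₀ p)
    (q : B4.Idx (pbox M) d') : covDiffLam L' M k m Λ'₀ p q = 0 := by
  have h0 : ∀ Δ : Matrix (B4.Idx (pbox M) d') (B4.Idx (pbox M) d') ℝ, (bondReductionLam L' M Λ'₀ Δ).cov p q = 0 := fun Δ => by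
    rw [subFamilyT_cov, Matrix.mul_assoc, Matrix.mul_apply]
    refine Finset.sum_eq_zero fun kk _ => ?_
    have hk := mem_lamFree.1 kk.2
    have hz : B6Cov2156TorusSubset.elimTS L' M (lamFree L' M Λ'₀) (lamFree_subset L' M Λ'₀) p kk = 0 := elimT_eq_zero_of_not_isLam hL (pos_of_neZero M) hLM hp hk.1 hk.2
    rw [hz, zero_mul]
  unfold covDiffLam
  rw [h0, h0, sub_self]

end Diff

/-! ## §2 The Dirichlet unit kernel and the region predicate on the socket carrier; `NE2PlusUnit` by name -/

section Layer

variable {I : Type} (hL : Odd L ∧ 1 < L) (ι : I → TGIndex) (Mc : I → ℝ) (X : I → Type) [∀ i, Fintype (X i)]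
  (blk : ∀ i, X i → Tor (TGIndex.Mn d hL (ι i))) (gf : I → B9.Geometry) (Bc Bf : I → B9.Backgrounds) (Λr : I → Finset (Fin (d + 1) → ℤ))

variable (d) in
/-- **THE (2.156) DIRICHLET COVARIANCE η-DIFFERENCE RE-BASED ON THE SOCKET CARRIER** (S-D's `covOnS` with the region `Λ = B(Λr i)` of the index): U-blind, reads the base points.
[cite: Balaban1984PropagatorsII, (2.156) p.250 (object); Balaban1985BackgroundPropagators, Thm 3.15 (3.187) p.432 (shape of `C^{(k)}_Λ`)] -/
def covOnSLam (α β : Fin (d + 1)) (B : I → B9.Backgrounds) (i : I) : B9.SiteKernel (opGeo (geoS d hL ι Mc i) (X i) (blk i)) (B i) :=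
  ⟨fun _ y y' => covDiffLam L (TGIndex.Mn d hL (ι i)) (ι i).k (ι i).m (Λr i)
      (⟨rep (TGIndex.Mn d hL (ι i)) y, rep_mem_pbox (TGIndex.Mn d hL (ι i)) y⟩, α) (⟨rep (TGIndex.Mn d hL (ι i)) y', rep_mem_pbox (TGIndex.Mn d hL (ι i)) y'⟩, β)⟩

variable (d) in
/-- **THE REGION PREDICATE ON THE SOCKET CARRIER**: the unit-lattice point `y` lies in `Λ = B(Λr i)` modulo the periods (Literature `InLam`) — [B9] Thm 3.15's «y, y′ ∈ Λ»; a dictionary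
predicate, no mathematical content. [folklore] -/
@[folklore]
def inLamS (i : I) : (opGeo (geoS d hL ι Mc i) (X i) (blk i)).Site → Prop :=
  fun y => InLam L (TGIndex.Mn d hL (ι i)) (Λr i) (rep (TGIndex.Mn d hL (ι i)) y)

omit [NeZero L] in
/-- Unfolding of `covOnSLam`. [folklore] -/
theorem covOnSLam_ker (α β : Fin (d + 1)) (i : I) (U : (Bf i).Cfg) (y y' : Tor (TGIndex.Mn d hL (ι i))) :
    (covOnSLam d hL ι Mc X blk Λr α β Bf i).ker U y y' = covDiffLam L (TGIndex.Mn d hL (ι i)) (ι i).k (ι i).m (Λr i)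
      (⟨rep (TGIndex.Mn d hL (ι i)) y, rep_mem_pbox (TGIndex.Mn d hL (ι i)) y⟩, α) (⟨rep (TGIndex.Mn d hL (ι i)) y', rep_mem_pbox (TGIndex.Mn d hL (ι i)) y'⟩, β) := rfl

omit [NeZero L] in
/-- Unfolding of `inLamS`. [folklore] -/
theorem inLamS_iff (i : I) (y : Tor (TGIndex.Mn d hL (ι i))) : inLamS d hL ι Mc X blk Λr i y ↔ InLam L (TGIndex.Mn d hL (ι i)) (Λr i) (rep (TGIndex.Mn d hL (ι i)) y) := Iff.rfl

omit [NeZero L] in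
/-- NON-VACUITY OF THE REGION PREDICATE: a region whose coarse sites contain the origin is met by the origin of the unit torus. [folklore] -/
theorem inLamS_zero (i : I) (h0 : (0 : Fin (d + 1) → ℤ) ∈ Λr i) : inLamS d hL ι Mc X blk Λr i (0 : Tor (TGIndex.Mn d hL (ι i))) := by
  show InLam L (TGIndex.Mn d hL (ι i)) (Λr i) (rep (TGIndex.Mn d hL (ι i)) 0)
  have hrep : rep (TGIndex.Mn d hL (ι i)) (0 : Tor (TGIndex.Mn d hL (ι i))) = 0 := by funext μ; simp [rep]
  unfold InLam
  rw [hrep]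
  have hw : B6Lemma24Torus.wrap (TGIndex.Mn d hL (ι i)) (0 : Fin (d + 1) → ℤ) = 0 := by funext μ; simp [B6Lemma24Torus.wrap]
  have hc : B6Elimination.corner L (0 : Fin (d + 1) → ℤ) = 0 := by funext μ; simp [B6Elimination.corner]
  rw [hw, hc]; exact h0

/-- ★ **CONSISTENCY WITH S-D**: when `Λr i ⊇` all coarse sites of the torus the Dirichlet kernel IS S-D's `covOnS` (`covDiffLam_eq_covDiff`). [cite: Balaban1984PropagatorsII, (2.156) p.250] -/
theorem covOnSLam_ker_eq_covOnS (α β : Fin (d + 1)) (i : I) (hΛ : coarseSites L (TGIndex.Mn d hL (ι i)) ⊆ Λr i) (U : (Bf i).Cfg) (y y' : Tor (TGIndex.Mn d hL (ι i))) :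
    (covOnSLam d hL ι Mc X blk Λr α β Bf i).ker U y y' = (covOnS d hL α β ι Mc X blk Bf i).ker U y y' := by
  have hLpos : 0 < L := Nat.pos_of_ne_zero (NeZero.ne L)
  rw [covOnSLam_ker, covOnS_ker, tgCovStep_ker, covDiffLam_eq_covDiff hLpos hΛ]

/-- ★ **DIRICHLET — OUTSIDE THE REGION THE KERNEL VANISHES** (torus L-divisible, `m_T ≥ 1`): if the bond `(ȳ, α)` does not meet `Λ = B(Λr i)` then `(covOnSLam …).ker U y y′ = 0` for every `U, y′`.
[cite: Balaban1984PropagatorsII, p.250 («CB′ = 0 outside Λ»); Balaban1985BackgroundPropagators, §E p.428 («B = 0 on Λᶜ»)] -/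
theorem covOnSLam_ker_eq_zero_of_not_isLam (α β : Fin (d + 1)) (i : I) (hι : 1 ≤ (ι i).mT) (U : (Bf i).Cfg) {y : Tor (TGIndex.Mn d hL (ι i))}
    (hy : ¬ IsLam L (TGIndex.Mn d hL (ι i)) (Λr i) (⟨rep (TGIndex.Mn d hL (ι i)) y, rep_mem_pbox (TGIndex.Mn d hL (ι i)) y⟩, α)) (y' : Tor (TGIndex.Mn d hL (ι i))) :
    (covOnSLam d hL ι Mc X blk Λr α β Bf i).ker U y y' = 0 := by
  have hLpos : 0 < L := Nat.pos_of_ne_zero (NeZero.ne L)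
  rw [covOnSLam_ker]
  exact covDiffLam_eq_zero_of_not_isLam hLpos (dvd_Mn (d := d) hL ⟨ι i, hι⟩) _ _ _ hy _

/-- ★★ **`NE2PlusUnit` FOR THE RE-BASED (2.156) DIRICHLET COVARIANCE, REGION GENUINE, CONSTANTS UNIFORM IN THE INDEX AND THE REGION** on any socket family whose torus indices are
L-divisible (`m_T ≥ 1`; `d ≥ 1`, `L ≥ 2`), every direction pair, every region map `Λr` and `c₃₅`: constants `(δ₀, a₀, B₀, θ) = (δ′, 1, C′, L⁻¹)` of the Literature's `cov2156_rate_lam`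
(King's (4.38) shape for `C^{(k)}_Λ` at `U = 1`, ONE `(C′, δ′)` in `(d, L)` for every torus AND every `Λ = B(Λ′₀)`), clean rate `θ = L⁻¹ < 1`; `inΛ := inLamS` ([B9] (3.187)'s «y, y′ ∈ Λ» —
the bound in fact holds at every pair of sites, the kernel vanishing off Λ); the regularity hypotheses are idle (U-blind kernel) — said.
[cite: Balaban1985BackgroundPropagators, Thm 3.15 (3.187) p.432 (quantifier template, constants in d, L only); Balaban1984PropagatorsII, (2.154)–(2.157) pp.249–250; King1986, Lemma 4.5 (4.38) p.674 (shape)] -/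
theorem ne2PlusUnit_covOnSLam (hd : 1 ≤ d) (hL2 : 2 ≤ L) (hι : ∀ i, 1 ≤ (ι i).mT)
    (pair : ∀ i, EtaPairing (opGeo (geoS d hL ι Mc i) (X i) (blk i)) (gf i) (Bc i) (Bf i)) (α β : Fin (d + 1)) (c35 : ℝ) :
    NE2PlusUnit c35 (fun i => (⟨opGeo (geoS d hL ι Mc i) (X i) (blk i), gf i, Bc i, Bf i, pair i⟩ : PairedInstance)) (covOnSLam d hL ι Mc X blk Λr α β Bf)
      (inLamS d hL ι Mc X blk Λr) (fun i => (opGeo (geoS d hL ι Mc i) (X i) (blk i)).dist) := by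
  have hL1 : 1 ≤ L := Nat.one_le_iff_ne_zero.mpr (NeZero.ne L)
  obtain ⟨C', δ', hC', hδ', H⟩ := cov2156_rate_lam (d + 1) (by omega) hL1
  have hLpos : (0 : ℝ) < L := by exact_mod_cast (lt_of_lt_of_le zero_lt_two hL2)
  have hθ1 : ((L : ℝ)⁻¹) < 1 := inv_lt_one_of_one_lt₀ (by exact_mod_cast hL2)
  refine ⟨δ', 1, C', (L : ℝ)⁻¹, hδ', one_pos, hC', inv_pos.mpr hLpos, hθ1, fun i _ _ _ U _ _ y y' _ _ => ?_⟩
  have hLk : 1 ≤ L ^ (ι i).k := Nat.one_le_pow _ _ hL1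
  have hLm : 1 ≤ L ^ (ι i).m := Nat.one_le_pow _ _ hL1
  have h := H (TGIndex.Mn d hL (ι i)) (dvd_Mn (d := d) hL ⟨ι i, hι i⟩) (L ^ (ι i).k) (L ^ ((ι i).k + (ι i).m)) (L ^ (ι i).m) hLk hLm (by rw [pow_add, mul_comm]) (Λr i)
    (⟨rep (TGIndex.Mn d hL (ι i)) y, rep_mem_pbox (TGIndex.Mn d hL (ι i)) y⟩, α) (⟨rep (TGIndex.Mn d hL (ι i)) y', rep_mem_pbox (TGIndex.Mn d hL (ι i)) y'⟩, β)
  have hdist : pdist (TGIndex.Mn d hL (ι i)) (one_le_M (TGIndex.Mn d hL (ι i))) (rep (TGIndex.Mn d hL (ι i)) y) (rep (TGIndex.Mn d hL (ι i)) y')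
      = tdistT (TGIndex.Mn d hL (ι i)) y y' := pdist_rep_rep _ _ y y'
  show |covDiffLam L (TGIndex.Mn d hL (ι i)) (ι i).k (ι i).m (Λr i) (⟨rep (TGIndex.Mn d hL (ι i)) y, rep_mem_pbox (TGIndex.Mn d hL (ι i)) y⟩, α)
      (⟨rep (TGIndex.Mn d hL (ι i)) y', rep_mem_pbox (TGIndex.Mn d hL (ι i)) y'⟩, β)|
    ≤ C' * Real.exp (-(δ' * tdistT (TGIndex.Mn d hL (ι i)) y y')) * ((L : ℝ)⁻¹) ^ (ι i).k
  rw [← hdist, inv_pow]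
  have hcast : ((L ^ (ι i).k : ℕ) : ℝ) = (L : ℝ) ^ (ι i).k := by push_cast; rfl
  unfold covDiffLam
  calc _ ≤ C' * ((L ^ (ι i).k : ℕ) : ℝ)⁻¹ * Real.exp (-(δ' * pdist (TGIndex.Mn d hL (ι i)) (one_le_M (TGIndex.Mn d hL (ι i)))
            (rep (TGIndex.Mn d hL (ι i)) y) (rep (TGIndex.Mn d hL (ι i)) y'))) := h
    _ = _ := by rw [hcast]; ring

end Layer

/-! ## §3 The socket theorems with the Dirichlet region -/

section Knit

variable {I : Type} (hL : Odd L ∧ 1 < L) (ι : I → TGIndex) (Mc : I → ℝ) (X : I → Type) [∀ i, Fintype (X i)]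
  (blk : ∀ i, X i → Tor (TGIndex.Mn d hL (ι i))) (gf : I → B9.Geometry) (Bc Bf : I → B9.Backgrounds) (Λr : I → Finset (Fin (d + 1) → ℤ))

/-- ★★★ **THE SIZED `N15At` KNIT WITH A GENUINE DIRICHLET REGION IN THE UNIT LAYER**: for `d ≥ 1`, odd `L ≥ 3`, `a_S > 0`, directions `α β`, ANY index type with torus indices in `m_T ≥ 1`,
sizes `Mc`, argument lattices, fine geometries, background carriers, pairings, ANY region map `Λr`, letters `c₃₅`, `p`, and ANY operator family with `NE2PlusOperator` BY NAME:
`N15At ⟨I, c₃₅, p, pi, Kop, siteOnS a_S …, covOnSLam … Λr α β, inLamS … Λr, dist⟩` — S-D's `n15At_opGeoS_of_ne2PlusOperator` with the unit layer on `C^{(k)}_Λ` read on Λ. [bookkeeping] -/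
theorem n15At_opGeoS_of_ne2PlusOperator_lam (hd : 1 ≤ d) (hLodd : Odd L) (hL2 : 2 ≤ L) {aS : ℝ} (haS : 0 < aS) (α β : Fin (d + 1))
    (hι : ∀ i, 1 ≤ (ι i).mT) (pair : ∀ i, EtaPairing (opGeo (geoS d hL ι Mc i) (X i) (blk i)) (gf i) (Bc i) (Bf i)) {c35 : ℝ} (p : ℝ)
    (Kop : ∀ i, B9.KernelFamily (opGeo (geoS d hL ι Mc i) (X i) (blk i)) (Bf i))
    (hop : NE2PlusOperator c35 (fun i => (⟨opGeo (geoS d hL ι Mc i) (X i) (blk i), gf i, Bc i, Bf i, pair i⟩ : PairedInstance)) Kop) :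
    N15At { I := I, c35 := c35, p := p, pi := fun i => ⟨opGeo (geoS d hL ι Mc i) (X i) (blk i), gf i, Bc i, Bf i, pair i⟩, Kop := Kop,
            Ksite := siteOnS d hL aS ι Mc X blk Bf, Kunit := covOnSLam d hL ι Mc X blk Λr α β Bf, inΛ := inLamS d hL ι Mc X blk Λr,
            unitDist := fun i => (opGeo (geoS d hL ι Mc i) (X i) (blk i)).dist } :=
  ⟨hop, ne2PlusSite_siteOnS (d := d) hL ι Mc X blk gf Bc Bf hLodd hL2 haS pair 4 p c35, ne2PlusUnit_covOnSLam hL ι Mc X blk gf Bc Bf Λr hd hL2 hι pair α β c35⟩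

omit [NeZero L] in
/-- ★★ **THE FAMILY PASSES THE K3⁸ GUARD WITH THE GENUINE REGION PREDICATE — FOR ANY KERNELS** — when `(Mc, k ∘ ι)` is jointly cofinal, the fine carrier's trivial configuration is
(3.35)∕(3.36)-regular at every `α₀ > 0`, and every region contains the origin block (`0 ∈ Λr i`: clause (G5) «the region is met», by `inLamS_zero`). [bookkeeping] -/
theorem live_opGeoS_lam (pair : ∀ i, EtaPairing (opGeo (geoS d hL ι Mc i) (X i) (blk i)) (gf i) (Bc i) (Bf i)) (c35 p : ℝ)
    (Kop : ∀ i, B9.KernelFamily (opGeo (geoS d hL ι Mc i) (X i) (blk i)) (Bf i))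
    (Ksite Kunit : ∀ i, B9.SiteKernel (opGeo (geoS d hL ι Mc i) (X i) (blk i)) (Bf i))
    (hcof : ∀ (M₅ : ℝ) (k₀ : ℕ), ∃ i : I, M₅ ≤ Mc i ∧ k₀ ≤ (ι i).k)
    (hreg : ∀ (i : I) (α₀ : ℝ), 0 < α₀ → (Bf i).Reg335 c35 α₀ (Bf i).one ∧ (Bf i).Reg336 c35 α₀ (Bf i).one) (hΛ0 : ∀ i, (0 : Fin (d + 1) → ℤ) ∈ Λr i) :
    Live ⟨I, c35, p, fun i => ⟨opGeo (geoS d hL ι Mc i) (X i) (blk i), gf i, Bc i, Bf i, pair i⟩, Kop, Ksite, Kunit, inLamS d hL ι Mc X blk Λr,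
      fun i => (opGeo (geoS d hL ι Mc i) (X i) (blk i)).dist⟩ := by
  refine ⟨fun M₅ k₀ => ?_, fun i α₀ hα₀ => hreg i α₀ hα₀, fun i => ⟨(0 : Tor (TGIndex.Mn d hL (ι i))), inLamS_zero hL ι Mc X blk Λr i (hΛ0 i)⟩⟩
  obtain ⟨i, hM, hk⟩ := hcof M₅ k₀
  refine ⟨i, ?_, hk⟩
  show M₅ ≤ (gf i).M
  rw [(pair i).M_eq]
  exact hM

/-- ★★ **GUARD ∧ `N15At` TOGETHER** with the Dirichlet unit layer, from an operator layer BY NAME, joint cofinality, the trivial-configuration regularity and origin-anchored regions. [bookkeeping] -/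
theorem live_and_n15At_opGeoS_of_ne2PlusOperator_lam (hd : 1 ≤ d) (hLodd : Odd L) (hL2 : 2 ≤ L) {aS : ℝ} (haS : 0 < aS) (α β : Fin (d + 1))
    (hι : ∀ i, 1 ≤ (ι i).mT) (pair : ∀ i, EtaPairing (opGeo (geoS d hL ι Mc i) (X i) (blk i)) (gf i) (Bc i) (Bf i)) {c35 : ℝ} (p : ℝ)
    (Kop : ∀ i, B9.KernelFamily (opGeo (geoS d hL ι Mc i) (X i) (blk i)) (Bf i))
    (hop : NE2PlusOperator c35 (fun i => (⟨opGeo (geoS d hL ι Mc i) (X i) (blk i), gf i, Bc i, Bf i, pair i⟩ : PairedInstance)) Kop)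
    (hcof : ∀ (M₅ : ℝ) (k₀ : ℕ), ∃ i : I, M₅ ≤ Mc i ∧ k₀ ≤ (ι i).k)
    (hreg : ∀ (i : I) (α₀ : ℝ), 0 < α₀ → (Bf i).Reg335 c35 α₀ (Bf i).one ∧ (Bf i).Reg336 c35 α₀ (Bf i).one) (hΛ0 : ∀ i, (0 : Fin (d + 1) → ℤ) ∈ Λr i) :
    Live ⟨I, c35, p, fun i => ⟨opGeo (geoS d hL ι Mc i) (X i) (blk i), gf i, Bc i, Bf i, pair i⟩, Kop, siteOnS d hL aS ι Mc X blk Bf,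
        covOnSLam d hL ι Mc X blk Λr α β Bf, inLamS d hL ι Mc X blk Λr, fun i => (opGeo (geoS d hL ι Mc i) (X i) (blk i)).dist⟩ ∧
      N15At { I := I, c35 := c35, p := p, pi := fun i => ⟨opGeo (geoS d hL ι Mc i) (X i) (blk i), gf i, Bc i, Bf i, pair i⟩, Kop := Kop,
              Ksite := siteOnS d hL aS ι Mc X blk Bf, Kunit := covOnSLam d hL ι Mc X blk Λr α β Bf, inΛ := inLamS d hL ι Mc X blk Λr,
              unitDist := fun i => (opGeo (geoS d hL ι Mc i) (X i) (blk i)).dist } :=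
  ⟨live_opGeoS_lam (d := d) hL ι Mc X blk gf Bc Bf Λr pair c35 p Kop _ _ hcof hreg hΛ0,
    n15At_opGeoS_of_ne2PlusOperator_lam (d := d) hL ι Mc X blk gf Bc Bf Λr hd hLodd hL2 haS α β hι pair p Kop hop⟩

variable {N : ℕ} [NeZero N] {key : (F : T4Family) → Datum F N → Prop}

/-- ★ **THE KEYED-HOME FACE** (part 30's interface) for the Dirichlet socket: a rate home admitting only literals of a key-indexed NE2 reading valued in a socket family with an operator layer BY
NAME has `S_N15 RRec`. [bookkeeping] -/
theorem s_N15_of_admits_opGeoS_of_ne2PlusOperator_lam (hd : 1 ≤ d) (hLodd : Odd L) (hL2 : 2 ≤ L) {aS : ℝ} (haS : 0 < aS) (α β : Fin (d + 1))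
    (hι : ∀ i, 1 ≤ (ι i).mT) (pair : ∀ i, EtaPairing (opGeo (geoS d hL ι Mc i) (X i) (blk i)) (gf i) (Bc i) (Bf i)) {c35 : ℝ} (p : ℝ)
    (Kop : ∀ i, B9.KernelFamily (opGeo (geoS d hL ι Mc i) (X i) (blk i)) (Bf i))
    (hop : NE2PlusOperator c35 (fun i => (⟨opGeo (geoS d hL ι Mc i) (X i) (blk i), gf i, Bc i, Bf i, pair i⟩ : PairedInstance)) Kop)
    (ne2At : ∀ {F : T4Family} {D : Datum F N}, key F D → (ℕ → ℝ) → List (ULoop F) → ℕ → NE2Objects₁₁) (RRec : RateRecordPred N)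
    (hadm : ∀ (F : T4Family) (D : Datum F N) (g₀ : ℕ → ℝ) (os : List (ULoop F)) (R : RateCarriers N), RRec F D g₀ os R →
      ∃ (h : key F D) (k : ℕ), R.ne2 = ne2OfRecord₁₁ (ne2At h g₀ os k))
    (h : ∀ (F : T4Family) (D : Datum F N) (h : key F D) (g₀ : ℕ → ℝ) (os : List (ULoop F)) (k : ℕ),
      ne2At h g₀ os k = ⟨I, c35, p, fun i => ⟨opGeo (geoS d hL ι Mc i) (X i) (blk i), gf i, Bc i, Bf i, pair i⟩, Kop, siteOnS d hL aS ι Mc X blk Bf,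
        covOnSLam d hL ι Mc X blk Λr α β Bf, inLamS d hL ι Mc X blk Λr, fun i => (opGeo (geoS d hL ι Mc i) (X i) (blk i)).dist⟩) :
    S_N15 RRec :=
  s_N15_of_admits ne2At RRec hadm fun F D hk g₀ os k => by
    rw [h F D hk g₀ os k]
    exact n15At_opGeoS_of_ne2PlusOperator_lam (d := d) hL ι Mc X blk gf Bc Bf Λr hd hLodd hL2 haS α β hι pair p Kop hop

end Knit

end Summit.QuantumFields.YangMills.BalabanUVNodes.N15.GenuineRecord

end
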